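import Summits.HodgeConjecture.HodgeConjecture.Theorems.F0P3cStCharTSMovingFrame    -- (this seat) «MOVING-FRAME★»: `exists_norm_one_frame`, `exists_section_continuousOn`; brings ★ UprLc's bricks (UpEval, MovingSection, EllOpen, …)
import Summits.HodgeConjecture.HodgeConjecture.Theorems.F0P3cStCharTSUprLi         -- ★ p851683 (this seat) `up_eq_zero_of_not_isRegularElt`; brings ★ instances `LocalUnitaryGroupCongrMeasure` (second countability)
import Summits.HodgeConjecture.HodgeConjecture.Theorems.F0P3cStCharTSUpClass       -- ★ p851684 (this seat) «UP-CLASS★» `isClassFunOn_up_of_upDef`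
import HarnessLib

/-!
# F0 · P3c · line LH6 «StCharTS» — «UP-MEAS∀★»: under the (UP-DEF) field equation, `α^G = up α` is BOREL MEASURABLE for EVERY measurable stable class function `α` on `regH`
# (the clause `UpSpec`.(1) of [Rogawski1990 §12.5 p. 183], with no local-constancy hypothesis on `α`) — so that, with ★ UP-CLASS (clause (2)), the named input `UpSpec` can be
# re-lettered by the pen to its clause (3), print's TRANSFER DISPLAY `∫_G f·α^G dg = ∫_H f^H·α dh`

Cell `pub/hodgecm-mathlib`, crux H413 = `stmt-HodgeConjecture-24833` (lane `--supports … --as helper`), route HCCMUnconditional; seat F0P3-p02 (g21); datum road of the (S-𝔇)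
organ `stub_EllipticPackage`, row `up` (MAP v5 §3).  PLAN `F0/P3/F0P3-p02/g21/UPMEAS-PLAN.v1.F0P3p02g21.md`, brick (M4).  THEOREMS ONLY; ★-only imports.
HONEST LABEL: HC_CM is proved only modulo the 7 printed citations (2 remaining named inputs: hLiu418 = `stmt-HodgeConjecture-24832`, h413 = `stmt-HodgeConjecture-24833`)
until rung 0 closes; this file closes no organ and is COUNT-NEUTRAL (`UpSpec` stays ONE named input; its regularity clauses (1)(2) are now ★ at the (UP-DEF) formula).

THE MATHEMATICS.  `up α x = D_G(x)⁻¹ Σ_q τ(q.out) D_H(q.out) κ(q.out, x) α(q.out)` reads `α` at `Quot.out` representatives of the matched stable classes; for `α` merely measurable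
the map `x ↦ α(q(x).out)` has no structure, but `α` is STABLE on `regH`, so any `G`-regular matched representative may be used instead (★ UP-EVAL `up_eq_sum_of_transversal`).
★ MOVING-FRAME provides, near every regular `x`, an open `V ∋ x`, the norm-one roots `u_a(y)` (`a ∈ A`) of `(charpoly y)_w` and matched `G`-regular sections `s_a(y) ∈ H_v` with
`U(1)`-slot `u_a(y)`, ALL CONTINUOUS ON `V`, forming a transversal of the matched classes of every `y ∈ V`; `τ(s_a y)` and `κ(s_a y, y)` are constant near `x` (★
`finTau_eventually_eq`, ★ `finKappaAt_eventually_eq`).  Hence on a smaller open `V′ ∋ x`: `up α y = D_G(y)⁻¹ Σ_{a∈A} c_a · D_H(S_a y) · α(S_a y)` with constants `c_a` and the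
MEASURABLE maps `S_a := V′.piecewise s_a 1` (Mathlib `ContinuousOn.measurable_piecewise`) — a measurable function of `y`.  `G^r` is second countable, so countably many such
`V′` cover it, and `up α = 0` off `G^r`: `up α` is measurable (§1, a countable-cover gluing lemma).
* §1 `measurable_of_locally_measurable` (generic: second-countable Borel space, `f` locally equal to measurable functions on an open `U`, `0` off `U`);
* §2 `exists_nhds_measurable_eq_up` (the local measurable representative of `up α` at a regular point); §3 HEAD `measurable_up_of_upDef_of_measurable`;
* §4 `upSpec_regularity_of_upDef` — clauses (1) ∧ (2) of `UpSpec` for every measurable stable `α` (with ★ UP-CLASS), the shape the pen re-letters against.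

## References
* [Rogawski1990] J. D. Rogawski, *Automorphic Representations of Unitary Groups in Three Variables*, Ann. of Math. Stud. 123 (1990): §12.5 p. 183 («`α^G` … is given by integration
  against a class function on `G`»; L. 12.5.1), §4.3 p. 43, §4.9 pp. 54–55, §5.4 p. 78.
* [LanglandsShelstad1987] R. P. Langlands, D. Shelstad, Math. Ann. 278 (1987), Lemma 4.1.A — background (local constancy of transfer factors).
-/

set_option autoImplicit false
-- the mandated namespace has the single-problem summit's repeated segment (`HodgeConjecture.HodgeConjecture`)
set_option linter.dupNamespace false

noncomputable section

open Polynomial Filter Topology MeasureTheory Set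
open NumberField IsDedekindDomain
open scoped Matrix MatrixGroups Classical
open Literature.NumberTheory.Rogawski1990 Literature.NumberTheory.Automorphic Literature.NumberTheory.Automorphic.UnitaryGroup
open Literature.NumberTheory.GaloisRepresentations

namespace Summit.HodgeConjecture.HodgeConjecture.Cruxes.H413.F0P3cStCharTSUpMeas

/-! ## §1 Gluing measurability along a countable open cover -/

section Generic

variable {X : Type*} [TopologicalSpace X] [SecondCountableTopology X] [MeasurableSpace X] [OpensMeasurableSpace X]
  {E : Type*} [MeasurableSpace E]

/-- **Locally measurable on an open set and constant off it ⇒ measurable** (second-countable source): if every point of the open `U` has an open neighbourhood on which `f` agrees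
with some measurable `g`, and `f = c` off `U`, then `f` is measurable (Lindelöf: countably many neighbourhoods cover `U`). [folklore] -/
theorem measurable_of_locally_measurable {U : Set X} (f : X → E) (c : E)
    (hloc : ∀ x ∈ U, ∃ V : Set X, IsOpen V ∧ x ∈ V ∧ ∃ g : X → E, Measurable g ∧ ∀ y ∈ V, f y = g y) (h0 : ∀ x, x ∉ U → f x = c) :
    Measurable f := by
  choose V hVo hxV g hgm hfg using hloc
  -- countable subcover of the family `V x hx`, indexed by the subtype `U`
  obtain ⟨T, hTc, hTU⟩ := TopologicalSpace.isOpen_iUnion_countable (fun p : U => V p.1 p.2) (fun p => hVo p.1 p.2)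
  intro B hB
  have hcov : ∀ y ∈ U, ∃ p ∈ T, y ∈ V p.1 p.2 := fun y hy => by
    have : y ∈ ⋃ p : U, V p.1 p.2 := Set.mem_iUnion.2 ⟨⟨y, hy⟩, hxV y hy⟩
    rw [← hTU] at this
    simpa only [Set.mem_iUnion, exists_prop] using this
  have hdec : f ⁻¹' B = (⋃ p ∈ T, (V p.1 p.2 ∩ g p.1 p.2 ⁻¹' B)) ∪ ((⋃ p ∈ T, V p.1 p.2)ᶜ ∩ {y | c ∈ B}) := by
    ext y
    simp only [Set.mem_preimage, Set.mem_union, Set.mem_iUnion, Set.mem_inter_iff, Set.mem_compl_iff, Set.mem_setOf_eq, exists_prop, not_exists, not_and]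
    constructor
    · intro hy
      by_cases hmem : ∃ p ∈ T, y ∈ V p.1 p.2
      · obtain ⟨p, hpT, hyp⟩ := hmem
        exact Or.inl ⟨p, hpT, hyp, by rwa [← hfg p.1 p.2 y hyp]⟩
      · push Not at hmem
        have hyU : y ∉ U := fun hyU => by obtain ⟨p, hpT, hyp⟩ := hcov y hyU; exact hmem p hpT hyp
        exact Or.inr ⟨hmem, by rwa [h0 y hyU] at hy⟩
    · rintro (⟨p, -, hyp, hgy⟩ | ⟨hnot, hc⟩)
      · rwa [hfg p.1 p.2 y hyp]
      · have hyU : y ∉ U := fun hyU => by obtain ⟨p, hpT, hyp⟩ := hcov y hyU; exact hnot p hpT hyp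
        rwa [h0 y hyU]
  rw [hdec]
  refine MeasurableSet.union (MeasurableSet.biUnion hTc fun p _ => (hVo p.1 p.2).measurableSet.inter (hgm p.1 p.2 hB)) ?_
  refine MeasurableSet.inter (MeasurableSet.biUnion hTc fun p _ => (hVo p.1 p.2).measurableSet).compl ?_
  by_cases hc : c ∈ B
  · simp only [hc, Set.setOf_true]; exact MeasurableSet.univ
  · simp only [hc, Set.setOf_false]; exact MeasurableSet.empty

end Generic

/-! ## §2 The local measurable representative of `up α` at a regular point -/

section Gqs

variable (L : Type) [Field L] [NumberField L] [IsCMField L] (v : HeightOneSpectrum (𝓞 ↥(maximalRealSubfield L)))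

/-- **At a regular `x`, `up α` agrees near `x` with a MEASURABLE function**, for every measurable stable class function `α` on `regH`, under (UP-DEF) with the junction letters `hStH hRegH
hDHst` and `D_G`, `D_H` measurable.  (★ MOVING-FRAME + ★ UP-EVAL + ★ local constancy of `τ`, `κ`; see the module docstring.) [cite: Rogawski1990, §12.5 Lemma 12.5.1 p. 183; §4.9 p. 55; §5.4 p. 78] -/
theorem exists_nhds_measurable_eq_up (μ : HeckeCharacter L)
    (hns : ∀ w : UnitaryGroup.PlacesOver L v, IsCMField.complexConj L • w.1 = w.1)
    [MeasurableSpace (Gqs L v)] [BorelSpace (Gqs L v)] [∀ γ : Gqs L v, MeasurableSpace (Gqs L v ⧸ Subgroup.centralizer ({γ} : Set (Gqs L v)))]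
    [MeasurableSpace (Gqs L v ⧸ Subgroup.center (Gqs L v))]
    [MeasurableSpace ((UnitaryGroup.cmDatum L 2 (Matrix.of fun i j : Fin 2 => if i.val + j.val + 1 = 2 then (1 : L) else 0)).Local v ×
      (UnitaryGroup.cmDatum L 1 (Matrix.of fun i j : Fin 1 => if i.val + j.val + 1 = 1 then (1 : L) else 0)).Local v)]
    [BorelSpace ((UnitaryGroup.cmDatum L 2 (Matrix.of fun i j : Fin 2 => if i.val + j.val + 1 = 2 then (1 : L) else 0)).Local v ×
      (UnitaryGroup.cmDatum L 1 (Matrix.of fun i j : Fin 1 => if i.val + j.val + 1 = 1 then (1 : L) else 0)).Local v)]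
    (𝔇 : Ch12Sec5.EllipticData (Gqs L v)
      ((UnitaryGroup.cmDatum L 2 (Matrix.of fun i j : Fin 2 => if i.val + j.val + 1 = 2 then (1 : L) else 0)).Local v ×
        (UnitaryGroup.cmDatum L 1 (Matrix.of fun i j : Fin 1 => if i.val + j.val + 1 = 1 then (1 : L) else 0)).Local v))
    (hStH : ∀ a b, 𝔇.stConjH a b ↔ IsLocalStablyConjH L v a b)
    (hRegH : ∀ a, IsLocalGRegular L v a → a ∈ 𝔇.regH)
    (hDHst : ∀ a b, IsLocalGRegular L v a → IsLocalStablyConjH L v a b → 𝔇.DH b = 𝔇.DH a)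
    (hDGm : Measurable 𝔇.DG) (hDHm : Measurable 𝔇.DH)
    (hUp : ∀ (α : ((UnitaryGroup.cmDatum L 2 (Matrix.of fun i j : Fin 2 => if i.val + j.val + 1 = 2 then (1 : L) else 0)).Local v ×
        (UnitaryGroup.cmDatum L 1 (Matrix.of fun i j : Fin 1 => if i.val + j.val + 1 = 1 then (1 : L) else 0)).Local v) → ℂ) (x : Gqs L v),
      𝔇.up α x =
        if IsRegularElt (x.val : GL (Fin 3) (UnitaryGroup.LocalRing L v)) then
          ((𝔇.DG x : ℂ))⁻¹ *
            ∑ᶠ q : Quot (IsLocalStablyConjH L v),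
              (if IsLocalGRegular L v q.out ∧ IsLocalNormPair L (qsForm L) v q.out x then
                finTau L v q.out μ * (𝔇.DH q.out : ℂ) * ((finKappaAt L v (qsForm L) q.out x : ℤ) : ℂ) * α q.out
              else 0)
        else 0)
    (α : ((UnitaryGroup.cmDatum L 2 (Matrix.of fun i j : Fin 2 => if i.val + j.val + 1 = 2 then (1 : L) else 0)).Local v ×
        (UnitaryGroup.cmDatum L 1 (Matrix.of fun i j : Fin 1 => if i.val + j.val + 1 = 1 then (1 : L) else 0)).Local v) → ℂ)
    (hα : Ch12Sec5.IsStableClassFunOn 𝔇.stConjH 𝔇.regH α) (hαm : Measurable α)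
    (x : Gqs L v) (hx : IsRegularElt (x.val : GL (Fin 3) (UnitaryGroup.LocalRing L v))) :
    ∃ V : Set (Gqs L v), IsOpen V ∧ x ∈ V ∧ ∃ g : Gqs L v → ℂ, Measurable g ∧ ∀ y ∈ V, 𝔇.up α y = g y := by
  haveI : Algebra.IsQuadraticExtension ↥(maximalRealSubfield L) L := IsCMField.isQuadraticExtension L
  obtain ⟨w⟩ := UnitaryGroup.PlacesOver.nonempty L v
  have hw := hns w
  haveI : ProperSpace (w.1.adicCompletion L) := properSpace_adicCompletion L w.1
  set φ := Pi.evalRingHom (fun w' : UnitaryGroup.PlacesOver L v => w'.1.adicCompletion L) w with hφ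
  set σ := conjLocal L (IsCMField.complexConj L) v with hσ
  set σw := galAdicCompletionMap (L := L) (IsCMField.complexConj L) hw with hσw
  set P : Gqs L v → (w.1.adicCompletion L)[X] := fun y => ((y.val : GL (Fin 3) (UnitaryGroup.LocalRing L v)).val.charpoly).map φ with hP
  have hφinj : Function.Injective φ := F0P3cStCharTSEllOpen.evalPlace_injective L v w hw
  -- (1) ★ MOVING-FRAME: the norm-one roots, continuous on an open `V₀ ∋ x`
  obtain ⟨V₀, A, u, hV₀o, hxV₀, hregV₀, hu0, huc, hroot1, hdist, hexh⟩ := F0P3cStCharTSMovingFrame.exists_norm_one_frame L v w hw x hx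
  -- (2) lift to `R`
  obtain ⟨ψ, hψc, hψ⟩ := F0P3cStCharTSMovingSection.exists_continuous_rightInverse_evalPlace L v w hw
  have hUc : ∀ a ∈ A, ∀ y ∈ V₀, ContinuousAt (fun y => ψ (u a y)) y := fun a ha y hy => hψc.continuousAt.comp (huc a ha y hy)
  have hevR : ∀ a ∈ A, ∀ y ∈ V₀, IsRegularElt (y.val : GL (Fin 3) (UnitaryGroup.LocalRing L v)) ∧
      ((y.val : GL (Fin 3) (UnitaryGroup.LocalRing L v)).val.charpoly).IsRoot (ψ (u a y)) ∧ σ (ψ (u a y)) * ψ (u a y) = 1 := fun a ha y hy => by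
    refine ⟨hregV₀ y hy, ?_, ?_⟩
    · refine F0P3cStCharTSMovingSection.isRoot_of_isRoot_map_evalPlace L v w hw _ _ ?_
      rw [hψ]; exact (hroot1 a ha y hy).1
    · refine F0P3cStCharTSMovingSection.conj_mul_eq_one_of_evalPlace L v w hw _ ?_
      rw [hψ]; exact (hroot1 a ha y hy).2
  -- (3) ★ MOVING-FRAME sections, continuous on open sets `Va a ∋ x`, `Va a ⊆ V₀`
  have hM3 : ∀ a : w.1.adicCompletion L, ∃ (s : Gqs L v →
      (UnitaryGroup.cmDatum L 2 (Matrix.of fun i j : Fin 2 => if i.val + j.val + 1 = 2 then (1 : L) else 0)).Local v ×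
        (UnitaryGroup.cmDatum L 1 (Matrix.of fun i j : Fin 1 => if i.val + j.val + 1 = 1 then (1 : L) else 0)).Local v) (Va : Set (Gqs L v)),
      a ∈ A → IsOpen Va ∧ x ∈ Va ∧ Va ⊆ V₀ ∧ (∀ y ∈ Va, ContinuousAt s y) ∧
        ∀ y ∈ Va, IsLocalGRegular L v (s y) ∧ IsLocalNormPair L (qsForm L) v (s y) y ∧ finGammaTwo L v (s y) = ψ (u a y) := fun a => by
    by_cases ha : a ∈ A
    · obtain ⟨s, Va, hVao, hxVa, hVaV₀, hsc, hsev⟩ :=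
        F0P3cStCharTSMovingFrame.exists_section_continuousOn L v w hw hV₀o hxV₀ (fun y => ψ (u a y)) (hUc a ha) (hevR a ha)
      exact ⟨s, Va, fun _ => ⟨hVao, hxVa, hVaV₀, hsc, hsev⟩⟩
    · exact ⟨fun _ => 1, Set.univ, fun h => absurd h ha⟩
  choose s Va hM3 using hM3
  have hVao : ∀ a ∈ A, IsOpen (Va a) := fun a ha => (hM3 a ha).1
  have hxVa : ∀ a ∈ A, x ∈ Va a := fun a ha => (hM3 a ha).2.1
  have hsc : ∀ a ∈ A, ∀ y ∈ Va a, ContinuousAt (s a) y := fun a ha => (hM3 a ha).2.2.2.1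
  have hsev : ∀ a ∈ A, ∀ y ∈ Va a, IsLocalGRegular L v (s a y) ∧ IsLocalNormPair L (qsForm L) v (s a y) y ∧ finGammaTwo L v (s a y) = ψ (u a y) :=
    fun a ha => (hM3 a ha).2.2.2.2
  have hsx : ∀ a ∈ A, IsLocalGRegular L v (s a x) ∧ IsLocalNormPair L (qsForm L) v (s a x) x ∧ finGammaTwo L v (s a x) = ψ (u a x) :=
    fun a ha => hsev a ha x (hxVa a ha)
  -- (4) `τ` and `κ` are constant near `x` along `y ↦ (s_a y, y)`
  have hτκ : ∀ᶠ y in 𝓝 x, ∀ a ∈ A, IsLocalNormPair L (qsForm L) v (s a y) y →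
      finTau L v (s a y) μ = finTau L v (s a x) μ ∧ finKappaAt L v (qsForm L) (s a y) y = finKappaAt L v (qsForm L) (s a x) x := by
    rw [Filter.eventually_all_finset]
    intro a ha
    obtain ⟨hregx, hnpx, -⟩ := hsx a ha
    have hux : IsUnit ((finCharpolyTwo L v (s a x)).eval (finGammaTwo L v (s a x))) := isUnit_eval_finCharpolyTwo_of_isLocalGRegular L v (s a x) hregx
    have hτ := ((hsc a ha x (hxVa a ha)).tendsto).eventually (finTau_eventually_eq L v μ hux)
    have hpair : Tendsto (fun y => (s a y, y)) (𝓝 x) (𝓝 (s a x, x)) := ((hsc a ha x (hxVa a ha)).prodMk continuousAt_id).tendsto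
    have hκ := hpair.eventually (finKappaAt_eventually_eq L v (qsForm L) (F0P3cStCharTSCharField.qsForm_map_cmConjRingHom_transpose L)
      (F0P3cStCharTSCharField.det_qsForm_ne_zero L) hnpx hux)
    filter_upwards [hτ, hκ] with y hyτ hyκ hnp
    exact ⟨hyτ, hyκ hnp⟩
  obtain ⟨O, hOsub, hOopen, hxO⟩ := mem_nhds_iff.1 hτκ
  -- (5) the open set `V := V₀ ∩ O ∩ ⋂_{a ∈ A} Va a` and the measurable sections `S a := V.piecewise (s a) 1`
  set V : Set (Gqs L v) := V₀ ∩ O ∩ ⋂ a ∈ A, Va a with hVdef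
  have hVo : IsOpen V := (hV₀o.inter hOopen).inter (isOpen_biInter_finset fun a ha => hVao a ha)
  have hxV : x ∈ V := ⟨⟨hxV₀, hxO⟩, Set.mem_iInter₂.2 fun a ha => hxVa a ha⟩
  have hVVa : ∀ a ∈ A, V ⊆ Va a := fun a ha y hy => Set.mem_iInter₂.1 hy.2 a ha
  set S : w.1.adicCompletion L → Gqs L v →
      (UnitaryGroup.cmDatum L 2 (Matrix.of fun i j : Fin 2 => if i.val + j.val + 1 = 2 then (1 : L) else 0)).Local v ×
        (UnitaryGroup.cmDatum L 1 (Matrix.of fun i j : Fin 1 => if i.val + j.val + 1 = 1 then (1 : L) else 0)).Local v :=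
    fun a => V.piecewise (s a) (fun _ => 1) with hSdef
  have hSm : ∀ a ∈ A, Measurable (S a) := fun a ha =>
    ContinuousOn.measurable_piecewise (continuousOn_of_forall_continuousAt fun y hy => hsc a ha y (hVVa a ha hy)) continuousOn_const hVo.measurableSet
  have hSV : ∀ a, ∀ y ∈ V, S a y = s a y := fun a y hy => Set.piecewise_eq_of_mem _ _ _ hy
  -- (6) the measurable representative
  set g : Gqs L v → ℂ := fun y => ((𝔇.DG y : ℂ))⁻¹ *
      ∑ a ∈ A, finTau L v (s a x) μ * (𝔇.DH (S a y) : ℂ) * ((finKappaAt L v (qsForm L) (s a x) x : ℤ) : ℂ) * α (S a y) with hgdef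
  have hgm : Measurable g := by
    refine ((Complex.measurable_ofReal.comp hDGm).inv).mul (Finset.measurable_sum A fun a ha => ?_)
    exact ((measurable_const.mul (Complex.measurable_ofReal.comp (hDHm.comp (hSm a ha)))).mul measurable_const).mul (hαm.comp (hSm a ha))
  refine ⟨V, hVo, hxV, g, hgm, fun y hy => ?_⟩
  -- (7) at `y ∈ V`: the transversal formula (★ UP-EVAL), then the constants
  have hyV₀ : y ∈ V₀ := hy.1.1
  have hyreg : IsRegularElt (y.val : GL (Fin 3) (UnitaryGroup.LocalRing L v)) := hregV₀ y hyV₀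
  have hyA : ∀ a ∈ A, IsLocalGRegular L v (s a y) ∧ IsLocalNormPair L (qsForm L) v (s a y) y ∧ finGammaTwo L v (s a y) = ψ (u a y) :=
    fun a ha => hsev a ha y (hVVa a ha hy)
  have hslot : ∀ a ∈ A, ∀ a' ∈ A, finGammaTwo L v (s a y) = finGammaTwo L v (s a' y) → a = a' := by
    intro a ha a' ha' he
    rw [(hyA a ha).2.2, (hyA a' ha').2.2] at he
    have he' : u a y = u a' y := by rw [← hψ (u a y), ← hψ (u a' y)]; exact congrArg φ he
    exact hdist y hyV₀ a ha a' ha' he'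
  have hinj : Set.InjOn (fun a => s a y) ↑A := fun a ha a' ha' he => hslot a ha a' ha' (by simp only at he; rw [he])
  have hS' : ∀ t ∈ A.image (fun a => s a y), IsLocalGRegular L v t ∧ IsLocalNormPair L (qsForm L) v t y := by
    intro t ht
    obtain ⟨a, ha, rfl⟩ := Finset.mem_image.1 ht
    exact ⟨(hyA a ha).1, (hyA a ha).2.1⟩
  have hpair : ∀ t ∈ A.image (fun a => s a y), ∀ t' ∈ A.image (fun a => s a y), t ≠ t' → ¬ IsLocalStablyConjH L v t t' := by
    intro t ht t' ht' hne hst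
    obtain ⟨a, ha, rfl⟩ := Finset.mem_image.1 ht
    obtain ⟨a', ha', rfl⟩ := Finset.mem_image.1 ht'
    exact hne (by rw [hslot a ha a' ha' (hst.finGammaTwo_eq L v)])
  have hexhS : ∀ b, IsLocalGRegular L v b → IsLocalNormPair L (qsForm L) v b y → ∃ t ∈ A.image (fun a => s a y), IsLocalStablyConjH L v b t := by
    intro b hb hnp
    have hroot : (P y).IsRoot (φ (finGammaTwo L v b)) :=
      (F0P3cStCharTSEllOpen.isRoot_map_iff_of_injective φ hφinj _ _).2 (hnp.isRoot_finGammaTwo L (qsForm L) v)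
    have hone : σw (φ (finGammaTwo L v b)) * φ (finGammaTwo L v b) = 1 := by
      rw [mul_comm]
      exact apply_mul_map_apply_eq_one_of_local_one L v w hw b.2
    obtain ⟨a, ha, hra⟩ := hexh y hyV₀ _ hroot hone
    have hfg : finGammaTwo L v b = finGammaTwo L v (s a y) := by
      rw [(hyA a ha).2.2]
      apply hφinj
      rw [hψ]; exact hra
    exact ⟨s a y, Finset.mem_image_of_mem _ ha, isLocalStablyConjH_of_isLocalNormPair_of_finGammaTwo_eq L (qsForm L) v hb hnp (hyA a ha).2.1 hfg⟩
  rw [F0P3cStCharTSUpEval.up_eq_sum_of_transversal L v μ 𝔇 hStH hRegH hDHst hUp α hα y hyreg (A.image (fun a => s a y)) hS' hpair hexhS,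
    Finset.sum_image hinj, hgdef]
  simp only
  congr 1
  refine Finset.sum_congr rfl fun a ha => ?_
  obtain ⟨hτ, hκ⟩ := (hOsub hy.1.2) a ha (hyA a ha).2.1
  rw [hSV a y hy, hτ, hκ]

/-! ## §3 HEAD: `up α` is measurable for every measurable stable `α` -/

/-- **«UP-MEAS∀★» — `Measurable (𝔇.up α)` for EVERY measurable stable class function `α` on `regH`**, under (UP-DEF) (letters of ★ `upDom_of_upDef`: `hStH hRegH hDHst hUp`) and
measurability of `D_G`, `D_H` (junction letters `hDGm hDHm`), at a non-split `v`: the clause `UpSpec`.(1) [p. 183] at the (UP-DEF) formula with no local-constancy hypothesis.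
[cite: Rogawski1990, §12.5 p. 183; Lemma 12.5.1] -/
theorem measurable_up_of_upDef_of_measurable (μ : HeckeCharacter L)
    (hns : ∀ w : UnitaryGroup.PlacesOver L v, IsCMField.complexConj L • w.1 = w.1)
    [MeasurableSpace (Gqs L v)] [BorelSpace (Gqs L v)] [∀ γ : Gqs L v, MeasurableSpace (Gqs L v ⧸ Subgroup.centralizer ({γ} : Set (Gqs L v)))]
    [MeasurableSpace (Gqs L v ⧸ Subgroup.center (Gqs L v))]
    [MeasurableSpace ((UnitaryGroup.cmDatum L 2 (Matrix.of fun i j : Fin 2 => if i.val + j.val + 1 = 2 then (1 : L) else 0)).Local v ×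
      (UnitaryGroup.cmDatum L 1 (Matrix.of fun i j : Fin 1 => if i.val + j.val + 1 = 1 then (1 : L) else 0)).Local v)]
    [BorelSpace ((UnitaryGroup.cmDatum L 2 (Matrix.of fun i j : Fin 2 => if i.val + j.val + 1 = 2 then (1 : L) else 0)).Local v ×
      (UnitaryGroup.cmDatum L 1 (Matrix.of fun i j : Fin 1 => if i.val + j.val + 1 = 1 then (1 : L) else 0)).Local v)]
    (𝔇 : Ch12Sec5.EllipticData (Gqs L v)
      ((UnitaryGroup.cmDatum L 2 (Matrix.of fun i j : Fin 2 => if i.val + j.val + 1 = 2 then (1 : L) else 0)).Local v ×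
        (UnitaryGroup.cmDatum L 1 (Matrix.of fun i j : Fin 1 => if i.val + j.val + 1 = 1 then (1 : L) else 0)).Local v))
    (hStH : ∀ a b, 𝔇.stConjH a b ↔ IsLocalStablyConjH L v a b)
    (hRegH : ∀ a, IsLocalGRegular L v a → a ∈ 𝔇.regH)
    (hDHst : ∀ a b, IsLocalGRegular L v a → IsLocalStablyConjH L v a b → 𝔇.DH b = 𝔇.DH a)
    (hDGm : Measurable 𝔇.DG) (hDHm : Measurable 𝔇.DH)
    (hUp : ∀ (α : ((UnitaryGroup.cmDatum L 2 (Matrix.of fun i j : Fin 2 => if i.val + j.val + 1 = 2 then (1 : L) else 0)).Local v ×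
        (UnitaryGroup.cmDatum L 1 (Matrix.of fun i j : Fin 1 => if i.val + j.val + 1 = 1 then (1 : L) else 0)).Local v) → ℂ) (x : Gqs L v),
      𝔇.up α x =
        if IsRegularElt (x.val : GL (Fin 3) (UnitaryGroup.LocalRing L v)) then
          ((𝔇.DG x : ℂ))⁻¹ *
            ∑ᶠ q : Quot (IsLocalStablyConjH L v),
              (if IsLocalGRegular L v q.out ∧ IsLocalNormPair L (qsForm L) v q.out x then
                finTau L v q.out μ * (𝔇.DH q.out : ℂ) * ((finKappaAt L v (qsForm L) q.out x : ℤ) : ℂ) * α q.out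
              else 0)
        else 0)
    (α : ((UnitaryGroup.cmDatum L 2 (Matrix.of fun i j : Fin 2 => if i.val + j.val + 1 = 2 then (1 : L) else 0)).Local v ×
        (UnitaryGroup.cmDatum L 1 (Matrix.of fun i j : Fin 1 => if i.val + j.val + 1 = 1 then (1 : L) else 0)).Local v) → ℂ)
    (hα : Ch12Sec5.IsStableClassFunOn 𝔇.stConjH 𝔇.regH α) (hαm : Measurable α) :
    Measurable (𝔇.up α) :=
  measurable_of_locally_measurable (U := {x : Gqs L v | IsRegularElt (x.val : GL (Fin 3) (UnitaryGroup.LocalRing L v))}) (𝔇.up α) 0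
    (fun x hx => exists_nhds_measurable_eq_up L v μ hns 𝔇 hStH hRegH hDHst hDGm hDHm hUp α hα hαm x hx)
    (fun x hx => F0P3cStCharTSUprLi.up_eq_zero_of_not_isRegularElt L v μ 𝔇 hUp α x hx)

/-! ## §4 The regularity clauses (1) ∧ (2) of `UpSpec`, for every measurable stable `α` -/

/-- **`UpSpec` REGULARITY at the (UP-DEF) formula** — for EVERY measurable stable class function `α` on `regH`: `up α` is measurable (§3) AND a class function on `regG` (★ UP-CLASS
`isClassFunOn_up_of_upDef`, given that `D_G` is a class function, `hDGcl` — e.g. ★ `DG_conj_eq_of_formula`).  With this, the named input `UpSpec` [p. 183] is equivalent, at the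
(UP-DEF) datum, to its clause (3) alone (print's transfer display) — the re-lettering is the pen's call. [cite: Rogawski1990, §12.5 p. 183] -/
theorem upSpec_regularity_of_upDef (μ : HeckeCharacter L)
    (hns : ∀ w : UnitaryGroup.PlacesOver L v, IsCMField.complexConj L • w.1 = w.1)
    [MeasurableSpace (Gqs L v)] [BorelSpace (Gqs L v)] [∀ γ : Gqs L v, MeasurableSpace (Gqs L v ⧸ Subgroup.centralizer ({γ} : Set (Gqs L v)))]
    [MeasurableSpace (Gqs L v ⧸ Subgroup.center (Gqs L v))]
    [MeasurableSpace ((UnitaryGroup.cmDatum L 2 (Matrix.of fun i j : Fin 2 => if i.val + j.val + 1 = 2 then (1 : L) else 0)).Local v ×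
      (UnitaryGroup.cmDatum L 1 (Matrix.of fun i j : Fin 1 => if i.val + j.val + 1 = 1 then (1 : L) else 0)).Local v)]
    [BorelSpace ((UnitaryGroup.cmDatum L 2 (Matrix.of fun i j : Fin 2 => if i.val + j.val + 1 = 2 then (1 : L) else 0)).Local v ×
      (UnitaryGroup.cmDatum L 1 (Matrix.of fun i j : Fin 1 => if i.val + j.val + 1 = 1 then (1 : L) else 0)).Local v)]
    (𝔇 : Ch12Sec5.EllipticData (Gqs L v)
      ((UnitaryGroup.cmDatum L 2 (Matrix.of fun i j : Fin 2 => if i.val + j.val + 1 = 2 then (1 : L) else 0)).Local v ×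
        (UnitaryGroup.cmDatum L 1 (Matrix.of fun i j : Fin 1 => if i.val + j.val + 1 = 1 then (1 : L) else 0)).Local v))
    (hStH : ∀ a b, 𝔇.stConjH a b ↔ IsLocalStablyConjH L v a b)
    (hRegH : ∀ a, IsLocalGRegular L v a → a ∈ 𝔇.regH)
    (hDHst : ∀ a b, IsLocalGRegular L v a → IsLocalStablyConjH L v a b → 𝔇.DH b = 𝔇.DH a)
    (hDGm : Measurable 𝔇.DG) (hDHm : Measurable 𝔇.DH)
    (hDGcl : ∀ x y : Gqs L v, 𝔇.DG (y * x * y⁻¹) = 𝔇.DG x)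
    (hUp : ∀ (α : ((UnitaryGroup.cmDatum L 2 (Matrix.of fun i j : Fin 2 => if i.val + j.val + 1 = 2 then (1 : L) else 0)).Local v ×
        (UnitaryGroup.cmDatum L 1 (Matrix.of fun i j : Fin 1 => if i.val + j.val + 1 = 1 then (1 : L) else 0)).Local v) → ℂ) (x : Gqs L v),
      𝔇.up α x =
        if IsRegularElt (x.val : GL (Fin 3) (UnitaryGroup.LocalRing L v)) then
          ((𝔇.DG x : ℂ))⁻¹ *
            ∑ᶠ q : Quot (IsLocalStablyConjH L v),
              (if IsLocalGRegular L v q.out ∧ IsLocalNormPair L (qsForm L) v q.out x then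
                finTau L v q.out μ * (𝔇.DH q.out : ℂ) * ((finKappaAt L v (qsForm L) q.out x : ℤ) : ℂ) * α q.out
              else 0)
        else 0) :
    ∀ α : ((UnitaryGroup.cmDatum L 2 (Matrix.of fun i j : Fin 2 => if i.val + j.val + 1 = 2 then (1 : L) else 0)).Local v ×
        (UnitaryGroup.cmDatum L 1 (Matrix.of fun i j : Fin 1 => if i.val + j.val + 1 = 1 then (1 : L) else 0)).Local v) → ℂ,
      Measurable α → Ch12Sec5.IsStableClassFunOn 𝔇.stConjH 𝔇.regH α → Measurable (𝔇.up α) ∧ Ch12Sec5.IsClassFunOn 𝔇.regG (𝔇.up α) :=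
  fun α hαm hα => ⟨measurable_up_of_upDef_of_measurable L v μ hns 𝔇 hStH hRegH hDHst hDGm hDHm hUp α hα hαm,
    F0P3cStCharTSUpClass.isClassFunOn_up_of_upDef L v μ 𝔇 hUp hDGcl α 𝔇.regG⟩

/-! ## §5 The re-lettering: `UpSpec` ⟸ UP-TRANSFER (print's display, clause (3)) + ★ (1)(2) -/

/-- **`UpSpec` FROM ITS TRANSFER CLAUSE ALONE** at the (UP-DEF) datum: given UP-TRANSFER — for every measurable stable class function `α` on `regH`, every `f ∈ C_c^∞(G)`, every transfer
`f^H` of `f`, `∫_G f·α^G dμG = ∫_H f^H·α dμH` whenever both sides converge (the p. 183 display, clause (3) of ★ `EllipticData.UpSpec` verbatim) — the whole of `𝔇.UpSpec` holds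
(clauses (1)(2) by §4).  JUNCTION PLUG: `hUpSpec := upSpec_of_upTransfer … hUp hUpTr`. [cite: Rogawski1990, §12.5 p. 183] -/
theorem upSpec_of_upTransfer (μ : HeckeCharacter L)
    (hns : ∀ w : UnitaryGroup.PlacesOver L v, IsCMField.complexConj L • w.1 = w.1)
    [MeasurableSpace (Gqs L v)] [BorelSpace (Gqs L v)] [∀ γ : Gqs L v, MeasurableSpace (Gqs L v ⧸ Subgroup.centralizer ({γ} : Set (Gqs L v)))]
    [MeasurableSpace (Gqs L v ⧸ Subgroup.center (Gqs L v))]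
    [MeasurableSpace ((UnitaryGroup.cmDatum L 2 (Matrix.of fun i j : Fin 2 => if i.val + j.val + 1 = 2 then (1 : L) else 0)).Local v ×
      (UnitaryGroup.cmDatum L 1 (Matrix.of fun i j : Fin 1 => if i.val + j.val + 1 = 1 then (1 : L) else 0)).Local v)]
    [BorelSpace ((UnitaryGroup.cmDatum L 2 (Matrix.of fun i j : Fin 2 => if i.val + j.val + 1 = 2 then (1 : L) else 0)).Local v ×
      (UnitaryGroup.cmDatum L 1 (Matrix.of fun i j : Fin 1 => if i.val + j.val + 1 = 1 then (1 : L) else 0)).Local v)]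
    (𝔇 : Ch12Sec5.EllipticData (Gqs L v)
      ((UnitaryGroup.cmDatum L 2 (Matrix.of fun i j : Fin 2 => if i.val + j.val + 1 = 2 then (1 : L) else 0)).Local v ×
        (UnitaryGroup.cmDatum L 1 (Matrix.of fun i j : Fin 1 => if i.val + j.val + 1 = 1 then (1 : L) else 0)).Local v))
    (hStH : ∀ a b, 𝔇.stConjH a b ↔ IsLocalStablyConjH L v a b)
    (hRegH : ∀ a, IsLocalGRegular L v a → a ∈ 𝔇.regH)
    (hDHst : ∀ a b, IsLocalGRegular L v a → IsLocalStablyConjH L v a b → 𝔇.DH b = 𝔇.DH a)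
    (hDGm : Measurable 𝔇.DG) (hDHm : Measurable 𝔇.DH)
    (hDGcl : ∀ x y : Gqs L v, 𝔇.DG (y * x * y⁻¹) = 𝔇.DG x)
    (hUp : ∀ (α : ((UnitaryGroup.cmDatum L 2 (Matrix.of fun i j : Fin 2 => if i.val + j.val + 1 = 2 then (1 : L) else 0)).Local v ×
        (UnitaryGroup.cmDatum L 1 (Matrix.of fun i j : Fin 1 => if i.val + j.val + 1 = 1 then (1 : L) else 0)).Local v) → ℂ) (x : Gqs L v),
      𝔇.up α x =
        if IsRegularElt (x.val : GL (Fin 3) (UnitaryGroup.LocalRing L v)) then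
          ((𝔇.DG x : ℂ))⁻¹ *
            ∑ᶠ q : Quot (IsLocalStablyConjH L v),
              (if IsLocalGRegular L v q.out ∧ IsLocalNormPair L (qsForm L) v q.out x then
                finTau L v q.out μ * (𝔇.DH q.out : ℂ) * ((finKappaAt L v (qsForm L) q.out x : ℤ) : ℂ) * α q.out
              else 0)
        else 0)
    (hUpTr : ∀ α : ((UnitaryGroup.cmDatum L 2 (Matrix.of fun i j : Fin 2 => if i.val + j.val + 1 = 2 then (1 : L) else 0)).Local v ×
        (UnitaryGroup.cmDatum L 1 (Matrix.of fun i j : Fin 1 => if i.val + j.val + 1 = 1 then (1 : L) else 0)).Local v) → ℂ,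
      Measurable α → Ch12Sec5.IsStableClassFunOn 𝔇.stConjH 𝔇.regH α →
        ∀ f ∈ SchwartzBruhat (Gqs L v), ∀ fH : ((UnitaryGroup.cmDatum L 2 (Matrix.of fun i j : Fin 2 => if i.val + j.val + 1 = 2 then (1 : L) else 0)).Local v ×
            (UnitaryGroup.cmDatum L 1 (Matrix.of fun i j : Fin 1 => if i.val + j.val + 1 = 1 then (1 : L) else 0)).Local v) → ℂ, 𝔇.IsTransfer f fH →
          Integrable (fun g => f g * 𝔇.up α g) 𝔇.μG → Integrable (fun h => fH h * α h) 𝔇.μH →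
          ∫ g, f g * 𝔇.up α g ∂𝔇.μG = ∫ h, fH h * α h ∂𝔇.μH) :
    𝔇.UpSpec := fun α hαm hα =>
  ⟨measurable_up_of_upDef_of_measurable L v μ hns 𝔇 hStH hRegH hDHst hDGm hDHm hUp α hα hαm,
    F0P3cStCharTSUpClass.isClassFunOn_up_of_upDef L v μ 𝔇 hUp hDGcl α 𝔇.regG, hUpTr α hαm hα⟩

end Gqs

end Summit.HodgeConjecture.HodgeConjecture.Cruxes.H413.F0P3cStCharTSUpMeas

end
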